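import Summits.QuantumFields.YangMills.Theorems.LuscherReductionTwistedTraceScalingBODefect
import HarnessLib

/-!
# The (B-OD) CURRENCY: how the (C4)-core `L²` bound becomes `b_core²·(σ_BT·λ₀)²·‖φ⊗Ω_c‖²_w` — the quasimode constant `a₀`, the FP mass `Z`, `N̄`, `K₁(1,1)` and the
# inner fibre mass `M₂^{γ,in}` CANCEL (lane A of S-BASE, crux `TwistedTraceScaling` stmt-QuantumFields-20203, C4-CORE, the (OD) pen; `pub/ym-fleet/ym-luscher-20007-p1/COARSE-DESIGN.md` §30.4, §30.6 (c))

The field `hOD` of `RecordAnalyticInput` measures the defect against `(b β·Λ β)²·tubeNormSq w (boFun φ Ω)` with `Λ = σ_BT·λ₀(L³β)`, `σ_BT = btC/(Z·γ)` (the (B-T) constant of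
`…BTPointwiseTail.hT_of_fp_add`).  The (C4)-core estimate (`…BODefectCoreRecord.defect_core_record`) bounds `∫_{S_in} E_core² w` by
`(Z⁻¹a₀(ε_s+κ_P))²/(N̄(1−κ_P))·M₂^{γ,in}·(Λ₁/K₁(1,1))²·‖φ‖²₂`.  The five inputs that convert one into the other are all LANDED or queued:
(1) the core bound; (2) the quasimode floor of the (B-T) kernel `btC·K₁(1,1) ≥ (1−η_c)·a₀·M₂^{γ,in}` (`…BODefectCoreNorm.fpBOKernel_one_one_ge_of_quasimode` + `…BOCentralQuasimodeRate`);
(3) `‖φ⊗Ω_c‖²_w ≥ (1−κ)γ‖φ‖²₂` (`…BODefectCoreNorm.tubeNormSq_boFun_ge` + `…FibreMassBrick.fibreMass_brick_record`); (4) the fibre-mass ratio `γ = N̄M₂^γ ≤ 2N̄M₂^{γ,in}`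
(`…BOMassRatioHodge.massRatio_le_two`); (5) `Λ₁ = linkCE(L³β) ≤ 2λ₀(L³β)` (`exists_linkCE_le_two_mul_levelValue_zero`).
* ★★ `core_currency` — the real-number lemma: (1)–(5) ⇒ `I ≤ b_core²·(btC·Z⁻¹/γ·λ₀)²·T` with `b_core² = 8(ε+κ_P)²/((1−κ_P)(1−η)²(1−κ))` — no `a₀`, `Z`, `N̄`, `K₁`, `M₂^{γ,in}` left.
  With `…BOCentralQuasimodeRate.defectRate_hb_small` (`ε_s² = o(bareLambda)`, `1/6 < s < 1/4`) and `κ_P = O(β^{-2s})`, `η = β^{-1/5}`, `κ → 0` this is `hb_small` for the core part.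
* `sq_le_of_core_currency` — the same with `b_core` itself (`b_core = (ε+κ_P)·√(8/((1−κ_P)(1−η)²(1−κ)))`), in the literal shape `(b·Λ)²·T` of `hOD`.
HONEST FRAMING: bookkeeping (real arithmetic) for a stub of a child of the CONDITIONAL route R2b1; (C5), the hOD assembly, (B-ST), C4-CORE OPEN; not a gap, not Clay.
-/

set_option autoImplicit false

noncomputable section

open Real

namespace Summit.QuantumFields.YangMills.Theorems.FemtoTransferGap.TwoLattice.ConstTube
set_option maxHeartbeats 400000 in
/-- ★★ **THE (B-OD) CURRENCY LEMMA** (see the module docstring): from the core bound (1), the quasimode floor (2), the fibre-mass floor (3), the mass ratio (4) and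
`Λ₁ ≤ 2λ₀` (5):  `I ≤ (8(ε+κ_P)²/((1−κ_P)(1−η)²(1−κ)))·(btC·Zi/γ·λ₀)²·T`. [cite: Luscher1983, §3] [cite: SjostrandZworski2007, §2] -/
theorem core_currency {I T Zi a₀ ε κP Nbar M2in Λ₁ K₁ φ2 btC η γ κ lam0 : ℝ}
    (hZi : 0 < Zi) (ha₀ : 0 ≤ a₀) (hN : 0 < Nbar) (hM : 0 < M2in) (hK₁ : 0 < K₁) (hφ2 : 0 ≤ φ2) (hη : η < 1) (hκP : κP < 1) (hκ : κ < 1) (hγ : 0 < γ)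
    (hΛ₁ : 0 ≤ Λ₁)
    (h1 : I ≤ (Zi * a₀ * (ε + κP)) ^ 2 / (Nbar * (1 - κP)) * M2in * ((Λ₁ / K₁) ^ 2 * φ2))
    (h2 : (1 - η) * a₀ * M2in ≤ btC * K₁) (h3 : (1 - κ) * γ * φ2 ≤ T) (h4 : γ ≤ 2 * (Nbar * M2in)) (h5 : Λ₁ ≤ 2 * lam0) :
    I ≤ (8 * (ε + κP) ^ 2 / ((1 - κP) * (1 - η) ^ 2 * (1 - κ))) * (btC * Zi / γ * lam0) ^ 2 * T := by
  have hη1 : 0 < 1 - η := by linarith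
  have hκP1 : 0 < 1 - κP := by linarith
  have hκ1 : 0 < 1 - κ := by linarith
  have hlam : 0 ≤ lam0 := by linarith
  -- (2): `a₀ ≤ btC·K₁/((1−η)M₂in)`, and `btC ≥ 0`
  have hbtC : 0 ≤ btC := by
    have h : 0 ≤ btC * K₁ := le_trans (by positivity) h2
    by_contra hneg
    push Not at hneg
    nlinarith [mul_neg_of_neg_of_pos hneg hK₁]
  have hA1 : a₀ ≤ btC * K₁ / ((1 - η) * M2in) := by
    rw [le_div_iff₀ (by positivity)]; nlinarith [h2]
  have hA2 : a₀ ^ 2 ≤ (btC * K₁ / ((1 - η) * M2in)) ^ 2 := pow_le_pow_left₀ ha₀ hA1 2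
  have hΛ2 : Λ₁ ^ 2 ≤ (2 * lam0) ^ 2 := pow_le_pow_left₀ hΛ₁ h5 2
  -- step A: the core bound in terms of `btC`, `λ₀`
  have hX : (Zi * a₀ * (ε + κP)) ^ 2 / (Nbar * (1 - κP)) * M2in * ((Λ₁ / K₁) ^ 2 * φ2) ≤
      (Zi * (ε + κP)) ^ 2 / (Nbar * (1 - κP)) * φ2 * ((btC * K₁ / ((1 - η) * M2in)) ^ 2 * M2in * ((2 * lam0) ^ 2 / K₁ ^ 2)) := by
    have e1 : (Zi * a₀ * (ε + κP)) ^ 2 / (Nbar * (1 - κP)) * M2in * ((Λ₁ / K₁) ^ 2 * φ2) =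
        (Zi * (ε + κP)) ^ 2 / (Nbar * (1 - κP)) * φ2 * (a₀ ^ 2 * M2in * (Λ₁ ^ 2 / K₁ ^ 2)) := by
      rw [div_pow]; ring
    rw [e1]
    have hpre : 0 ≤ (Zi * (ε + κP)) ^ 2 / (Nbar * (1 - κP)) * φ2 := by positivity
    refine mul_le_mul_of_nonneg_left ?_ hpre
    have i1 : a₀ ^ 2 * M2in ≤ (btC * K₁ / ((1 - η) * M2in)) ^ 2 * M2in := mul_le_mul_of_nonneg_right hA2 hM.le
    have i2 : Λ₁ ^ 2 / K₁ ^ 2 ≤ (2 * lam0) ^ 2 / K₁ ^ 2 := div_le_div_of_nonneg_right hΛ2 (by positivity)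
    exact mul_le_mul i1 i2 (by positivity) (by positivity)
  have eA : (Zi * (ε + κP)) ^ 2 / (Nbar * (1 - κP)) * φ2 * ((btC * K₁ / ((1 - η) * M2in)) ^ 2 * M2in * ((2 * lam0) ^ 2 / K₁ ^ 2)) =
      4 * Zi ^ 2 * btC ^ 2 * (ε + κP) ^ 2 * lam0 ^ 2 * φ2 / ((1 - η) ^ 2 * M2in * Nbar * (1 - κP)) := by
    field_simp
    ring
  -- step B: the right-hand side from below
  have hB : (8 * (ε + κP) ^ 2 / ((1 - κP) * (1 - η) ^ 2 * (1 - κ))) * (btC * Zi / γ * lam0) ^ 2 * ((1 - κ) * γ * φ2) ≤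
      (8 * (ε + κP) ^ 2 / ((1 - κP) * (1 - η) ^ 2 * (1 - κ))) * (btC * Zi / γ * lam0) ^ 2 * T :=
    mul_le_mul_of_nonneg_left h3 (by positivity)
  have eB : (8 * (ε + κP) ^ 2 / ((1 - κP) * (1 - η) ^ 2 * (1 - κ))) * (btC * Zi / γ * lam0) ^ 2 * ((1 - κ) * γ * φ2) =
      8 * (ε + κP) ^ 2 * btC ^ 2 * Zi ^ 2 * lam0 ^ 2 * φ2 / ((1 - κP) * (1 - η) ^ 2 * γ) := by
    field_simp
  -- the mass ratio: `1/γ ≥ 1/(2 N̄ M₂in)`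
  have hC : 4 * Zi ^ 2 * btC ^ 2 * (ε + κP) ^ 2 * lam0 ^ 2 * φ2 / ((1 - η) ^ 2 * M2in * Nbar * (1 - κP)) ≤
      8 * (ε + κP) ^ 2 * btC ^ 2 * Zi ^ 2 * lam0 ^ 2 * φ2 / ((1 - κP) * (1 - η) ^ 2 * γ) := by
    rw [div_le_div_iff₀ (by positivity) (by positivity)]
    have hnum : 0 ≤ Zi ^ 2 * btC ^ 2 * (ε + κP) ^ 2 * lam0 ^ 2 * φ2 * ((1 - κP) * (1 - η) ^ 2) := by positivity
    have key : 4 * γ ≤ 8 * (M2in * Nbar) := by nlinarith [h4]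
    have h := mul_le_mul_of_nonneg_left key hnum
    have e1 : 4 * Zi ^ 2 * btC ^ 2 * (ε + κP) ^ 2 * lam0 ^ 2 * φ2 * ((1 - κP) * (1 - η) ^ 2 * γ) =
        Zi ^ 2 * btC ^ 2 * (ε + κP) ^ 2 * lam0 ^ 2 * φ2 * ((1 - κP) * (1 - η) ^ 2) * (4 * γ) := by ring
    have e2 : 8 * (ε + κP) ^ 2 * btC ^ 2 * Zi ^ 2 * lam0 ^ 2 * φ2 * ((1 - η) ^ 2 * M2in * Nbar * (1 - κP)) =
        Zi ^ 2 * btC ^ 2 * (ε + κP) ^ 2 * lam0 ^ 2 * φ2 * ((1 - κP) * (1 - η) ^ 2) * (8 * (M2in * Nbar)) := by ring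
    rw [e1, e2]; exact h
  calc I ≤ (Zi * a₀ * (ε + κP)) ^ 2 / (Nbar * (1 - κP)) * M2in * ((Λ₁ / K₁) ^ 2 * φ2) := h1
    _ ≤ 4 * Zi ^ 2 * btC ^ 2 * (ε + κP) ^ 2 * lam0 ^ 2 * φ2 / ((1 - η) ^ 2 * M2in * Nbar * (1 - κP)) := hX.trans_eq eA
    _ ≤ 8 * (ε + κP) ^ 2 * btC ^ 2 * Zi ^ 2 * lam0 ^ 2 * φ2 / ((1 - κP) * (1 - η) ^ 2 * γ) := hC
    _ = (8 * (ε + κP) ^ 2 / ((1 - κP) * (1 - η) ^ 2 * (1 - κ))) * (btC * Zi / γ * lam0) ^ 2 * ((1 - κ) * γ * φ2) := eB.symm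
    _ ≤ (8 * (ε + κP) ^ 2 / ((1 - κP) * (1 - η) ^ 2 * (1 - κ))) * (btC * Zi / γ * lam0) ^ 2 * T := hB

/-- ★ **The same in the literal shape `(b·Λ)²·T` of `hOD`**, `b = (ε+κ_P)·√(8/((1−κ_P)(1−η)²(1−κ)))`, `Λ = (btC·Zi/γ)·λ₀`. [cite: Luscher1983, §3] -/
theorem sq_le_of_core_currency {I T Zi a₀ ε κP Nbar M2in Λ₁ K₁ φ2 btC η γ κ lam0 : ℝ}
    (hZi : 0 < Zi) (ha₀ : 0 ≤ a₀) (hN : 0 < Nbar) (hM : 0 < M2in) (hK₁ : 0 < K₁) (hφ2 : 0 ≤ φ2) (hη : η < 1) (hκP : κP < 1) (hκ : κ < 1) (hγ : 0 < γ)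
    (hΛ₁ : 0 ≤ Λ₁)
    (h1 : I ≤ (Zi * a₀ * (ε + κP)) ^ 2 / (Nbar * (1 - κP)) * M2in * ((Λ₁ / K₁) ^ 2 * φ2))
    (h2 : (1 - η) * a₀ * M2in ≤ btC * K₁) (h3 : (1 - κ) * γ * φ2 ≤ T) (h4 : γ ≤ 2 * (Nbar * M2in)) (h5 : Λ₁ ≤ 2 * lam0) :
    I ≤ ((ε + κP) * Real.sqrt (8 / ((1 - κP) * (1 - η) ^ 2 * (1 - κ))) * (btC * Zi / γ * lam0)) ^ 2 * T := by
  have hη1 : 0 < 1 - η := by linarith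
  have hκP1 : 0 < 1 - κP := by linarith
  have hκ1 : 0 < 1 - κ := by linarith
  have h := core_currency hZi ha₀ hN hM hK₁ hφ2 hη hκP hκ hγ hΛ₁ h1 h2 h3 h4 h5
  have e : ((ε + κP) * Real.sqrt (8 / ((1 - κP) * (1 - η) ^ 2 * (1 - κ))) * (btC * Zi / γ * lam0)) ^ 2 =
      (8 * (ε + κP) ^ 2 / ((1 - κP) * (1 - η) ^ 2 * (1 - κ))) * (btC * Zi / γ * lam0) ^ 2 := by
    rw [mul_pow, mul_pow, Real.sq_sqrt (by positivity)]; ring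
  rw [e]; exact h

end Summit.QuantumFields.YangMills.Theorems.FemtoTransferGap.TwoLattice.ConstTube

end
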